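import Literature.Analysis.FluidPDE.BallisticFreeEnergyCoercivity
import Literature.Analysis.FluidPDE.ThermoLinearization
import HarnessLib

/-!
# The pointwise relative-energy inequality behind Březina–Feireisl 2018, Thm. 3.3

Fix a point `(t, x)` and the values there of a classical solution `(r, Θ, U)` of the complete
Euler system together with its first derivatives (`StrongPointData`), satisfying the pointwise
continuity equation, the momentum equation in convective form, and the internal-energy (temperature)
equation. For a state `w = (ρ, E, m)` of the phase space (`ρ, E > 0`, `ϑ = ϑ(ρ,E)`) let

* `relEnergyFull` = `½|m - ρU|²/ρ + R(ρ,ϑ | r,Θ)` — BF's relative energy (3.3) written with the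
  thermal part `EulerEOS.relEnergyThermo` (`E - Θρs(ρ,E) - ∂_ρH_Θ(r,Θ)(ρ-r) - H_Θ(r,Θ) = R` since
  `E = ρ e(ρ,ϑ)`);
* `rawRHS Z` = the integrand produced by inserting the test functions `φ₁ = ½|U|² - μ(r,Θ)`,
  `φ₂ = U`, `φ₃ = Θ` (and the cut-off `Z`) into the continuity / momentum / entropy identities
  of a dissipative measure-valued solution (BF (2.20)–(2.22)) plus `∂ₜ p(r,Θ)`:
  exactly the right-hand side of BF (3.5) before any manipulation.

Main results:
* `rawRHS_add_div_eq` — the algebraic identity (BF (3.7)→(3.9), Step 1):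
  `rawRHS + div(pU) = -ρ vᵀ(∇U)v + (p - p_w) divU - ((ρ-r)/r) Dₜp + ρ(s - Z(s_w)) DₜΘ
   + ρ (s - Z(s_w)) v·∇Θ`, `v = m/ρ - U`;
* (in `MVRelativeEnergyPointwiseBounds.lean`) the MASTER INEQUALITY `rawRHS + div(pU) ≤ C · relEnergyFull`
  uniformly for reference states in a compact `K` and data bounded by `M` (BF Steps 2–3 with the
  coercivity (3.8)).

Vectors are `EuclideanSpace ℝ (Fin 3)` but all pairings are written as explicit finite sums, the
form in which `DissipativeMVEuler.IsDissipativeMVSolution` consumes them. The file ends with the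
elementary finite-sum inequalities and the predicate `StrongPointData.Bounded M` (all data
bounded by `M`) used by the bounds.

## References

* J. Březina, E. Feireisl, J. Math. Soc. Japan 70 (2018), §3.1.1 (3.4)–(3.5), §3.2.2 (3.7)–(3.11).
* E. Feireisl, A. Novotný, Arch. Ration. Mech. Anal. 204 (2012), §3.
-/

noncomputable section

open Set Filter Function Metric
open scoped Topology

namespace Literature.Analysis.FluidPDE

namespace CompressibleEuler

/-- The values and first derivatives, at one space–time point, of a classical solution
`(r, Θ, U)` of the complete Euler system: `r, Θ` and their time derivatives `rt, Θt` and
gradients `gr, gΘ`; the velocity `U`, its time derivative `Ut` and its gradient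
`gU i j = ∂ⱼ Uᵢ`. [cite: BrezinaFeireisl2018, (3.2)] -/
structure StrongPointData where
  /-- density `r` -/
  r : ℝ
  /-- temperature `Θ` -/
  Θ : ℝ
  /-- `∂ₜ r` -/
  rt : ℝ
  /-- `∂ₜ Θ` -/
  Θt : ℝ
  /-- velocity `U` -/
  U : EuclideanSpace ℝ (Fin 3)
  /-- `∂ₜ U` -/
  Ut : EuclideanSpace ℝ (Fin 3)
  /-- `∇ r` -/
  gr : EuclideanSpace ℝ (Fin 3)
  /-- `∇ Θ` -/
  gΘ : EuclideanSpace ℝ (Fin 3)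
  /-- `∂ⱼ Uᵢ` -/
  gU : Fin 3 → Fin 3 → ℝ

namespace StrongPointData

variable (eos : EulerEOS) (d : StrongPointData)

/-- `div U = ∑ᵢ ∂ᵢUᵢ`. [folklore] -/
def divU : ℝ := ∑ i, d.gU i i

/-- Material derivative of the temperature, `DₜΘ = ∂ₜΘ + U·∇Θ`. [folklore] -/
def DtΘ : ℝ := d.Θt + ∑ i, d.gΘ i * d.U i

/-- Material derivative of the density, `Dₜr = ∂ₜr + U·∇r`. [folklore] -/
def Dtr : ℝ := d.rt + ∑ i, d.gr i * d.U i

/-- `∂_ρ p(r,Θ)`. [folklore] -/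
def pρ : ℝ := deriv (fun x => eos.p x d.Θ) d.r

/-- `∂_ϑ p(r,Θ)`. [folklore] -/
def pϑ : ℝ := deriv (fun θ => eos.p d.r θ) d.Θ

/-- `∂ₜ [p(r,Θ)] = p_ρ ∂ₜr + p_ϑ ∂ₜΘ` (chain rule). [folklore] -/
def pt : ℝ := d.pρ eos * d.rt + d.pϑ eos * d.Θt

/-- `∂ⱼ [p(r,Θ)] = p_ρ ∂ⱼr + p_ϑ ∂ⱼΘ`. [folklore] -/
def gp (j : Fin 3) : ℝ := d.pρ eos * d.gr j + d.pϑ eos * d.gΘ j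

/-- `∂_ρ μ(r,Θ) = p_ρ/r` (`BallisticFreeEnergy.IsGibbs.hasDerivAt_chemPotential_rho`). [folklore] -/
def μρ : ℝ := d.pρ eos / d.r

/-- `∂_Θ μ(r,Θ) = -s + p_ϑ/r` (`ThermoLinearization.IsGibbs.hasDerivAt_chemPotential_theta`).
[folklore] -/
def μϑ : ℝ := -(eos.s d.r d.Θ) + d.pϑ eos / d.r

/-- `∂ₜ φ₁` for the continuity test function `φ₁ = ½|U|² - μ(r,Θ)`:
`U·∂ₜU - (μ_ρ ∂ₜr + μ_Θ ∂ₜΘ)`. [cite: BrezinaFeireisl2018, (3.4)] -/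
def φ₁t : ℝ := (∑ i, d.U i * d.Ut i) - (d.μρ eos * d.rt + d.μϑ eos * d.Θt)

/-- `∂ⱼ φ₁ = ∑ᵢ Uᵢ ∂ⱼUᵢ - (μ_ρ ∂ⱼr + μ_Θ ∂ⱼΘ)`. [cite: BrezinaFeireisl2018, (3.4)] -/
def gφ₁ (j : Fin 3) : ℝ := (∑ i, d.U i * d.gU i j) - (d.μρ eos * d.gr j + d.μϑ eos * d.gΘ j)

/-- The momentum equation in convective form at the point:
`r (∂ₜUᵢ + ∑ⱼ Uⱼ ∂ⱼUᵢ) + ∂ᵢ p(r,Θ) = 0`. [cite: BrezinaFeireisl2018, (1.2)] -/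
def MomentumEq (eos : EulerEOS) (d : StrongPointData) : Prop :=
  ∀ i, d.r * (d.Ut i + ∑ j, d.U j * d.gU i j) + d.gp eos i = 0

/-- The continuity equation at the point: `∂ₜr + U·∇r + r divU = 0`.
[cite: BrezinaFeireisl2018, (1.1)] -/
def MassEq (d : StrongPointData) : Prop := d.Dtr + d.r * d.divU = 0

/-- The internal-energy (temperature) equation at the point, before using Gibbs' relation:
`e_ϑ(r,Θ) DₜΘ = -(p(r,Θ) - r² e_ρ(r,Θ)) divU / r`. [cite: BrezinaFeireisl2018, (1.1)–(1.3)] -/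
def TemperatureEq (eos : EulerEOS) (d : StrongPointData) : Prop :=
  deriv (fun θ => eos.e d.r θ) d.Θ * d.DtΘ =
    -(eos.p d.r d.Θ - d.r ^ 2 * deriv (fun x => eos.e x d.Θ) d.r) * d.divU / d.r

end StrongPointData

open StrongPointData

variable (eos : EulerEOS)

/-- The temperature `ϑ(ρ,E)` of the state `(ρ, E, m)`. [cite: BrezinaFeireisl2018, §2.2] -/
def stateTemp (ρ E : ℝ) : ℝ := eos.temperature ρ E

/-- BF's relative energy (3.3) of the state `(ρ,E,m)` against the data `(r,Θ,U)`, written as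
kinetic part plus `EulerEOS.relEnergyThermo` (valid form on `{ρ, E > 0}` where `E = ρe(ρ,ϑ(ρ,E))`):
`½|m - ρU|²/ρ + R(ρ, ϑ(ρ,E) | r, Θ)`. [cite: BrezinaFeireisl2018, (3.3)] -/
def relEnergyFull (d : StrongPointData) (ρ E : ℝ) (m : EuclideanSpace ℝ (Fin 3)) : ℝ :=
  (∑ i, (m i - ρ * d.U i) ^ 2) / (2 * ρ) + eos.relEnergyThermo d.r d.Θ ρ (stateTemp eos ρ E)

/-- The raw right-hand-side integrand obtained from the measure-valued identities with the test
functions `φ₁ = ½|U|² - μ(r,Θ)` (continuity), `U` (momentum), `Θ` (entropy, cut-off `Z`) and the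
term `∂ₜ p(r,Θ)`: `-[m·∂ₜU + (m⊗m/ρ):∇U + p(ρ,E) divU] + [ρ ∂ₜφ₁ + m·∇φ₁]
- [ρ Z(s(ρ,E)) ∂ₜΘ + Z(s(ρ,E)) m·∇Θ] + ∂ₜp(r,Θ)`. [cite: BrezinaFeireisl2018, (3.4)–(3.5)] -/
def rawRHS (Z : ℝ → ℝ) (d : StrongPointData) (ρ E : ℝ) (m : EuclideanSpace ℝ (Fin 3)) : ℝ :=
  -((∑ i, m i * d.Ut i) + (∑ i, ∑ j, m i * m j / ρ * d.gU i j) +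
      eos.p ρ (stateTemp eos ρ E) * d.divU) +
    (ρ * d.φ₁t eos + ∑ j, m j * d.gφ₁ eos j) -
    (ρ * Z (eos.s ρ (stateTemp eos ρ E)) * d.Θt +
      ∑ i, Z (eos.s ρ (stateTemp eos ρ E)) * m i * d.gΘ i) +
    d.pt eos

/-- The reduced form of the right-hand side (BF (3.9), Step 1): with `v = m/ρ - U`,
`-ρ vᵀ(∇U)v + (p(r,Θ) - p(ρ,E)) divU - ((ρ - r)/r)(∂ₜp + U·∇p) + ρ (s(r,Θ) - Z(s(ρ,E))) DₜΘ
 + ρ (s(r,Θ) - Z(s(ρ,E))) v·∇Θ`. [cite: BrezinaFeireisl2018, (3.9)] -/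
def reducedRHS (Z : ℝ → ℝ) (d : StrongPointData) (ρ E : ℝ) (m : EuclideanSpace ℝ (Fin 3)) : ℝ :=
  -(ρ * ∑ i, ∑ j, (m i / ρ - d.U i) * (m j / ρ - d.U j) * d.gU i j) +
    (eos.p d.r d.Θ - eos.p ρ (stateTemp eos ρ E)) * d.divU -
    (ρ - d.r) / d.r * (d.pt eos + ∑ j, d.U j * d.gp eos j) +
    ρ * (eos.s d.r d.Θ - Z (eos.s ρ (stateTemp eos ρ E))) * d.DtΘ +
    ρ * (eos.s d.r d.Θ - Z (eos.s ρ (stateTemp eos ρ E))) *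
      ∑ i, (m i / ρ - d.U i) * d.gΘ i

/-- **Step 1 of BF §3.2.2 as an exact identity.** Under the pointwise momentum equation of the
strong solution, `rawRHS + (p(r,Θ) divU + U·∇p(r,Θ)) = reducedRHS` for every state with `ρ ≠ 0`
(the added term is `div(p(r,Θ)U)`, which integrates to zero over the torus).
[cite: BrezinaFeireisl2018, (3.7)–(3.9)] -/
theorem rawRHS_add_div_eq (Z : ℝ → ℝ) (d : StrongPointData) {ρ : ℝ} (hρ : ρ ≠ 0) (hr : d.r ≠ 0)
    (hmom : d.MomentumEq eos) (E : ℝ) (m : EuclideanSpace ℝ (Fin 3)) :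
    rawRHS eos Z d ρ E m + (eos.p d.r d.Θ * d.divU + ∑ j, d.U j * d.gp eos j) =
      reducedRHS eos Z d ρ E m := by
  -- eliminate `∂ₜU` through the momentum equation
  have hUt : ∀ i, d.Ut i = -(∑ j, d.U j * d.gU i j) - d.gp eos i / d.r := by
    intro i
    have h := hmom i
    field_simp
    linarith
  simp only [rawRHS, reducedRHS, φ₁t, gφ₁, μρ, μϑ, pt, DtΘ, divU, hUt]
  simp only [gp, Fin.sum_univ_three]
  field_simp
  ring

section Inequalities

open Finset

/-! ## Elementary inequalities (used by the bounds and by `ClassicalEulerTestFunctions`) -/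

/-- `|∑ aᵢbᵢ| ≤ M ∑|bᵢ|` if `|aᵢ| ≤ M`. [folklore] -/
theorem abs_sum_mul_le {ι : Type*} (s : Finset ι) {a b : ι → ℝ} {M : ℝ}
    (hM : ∀ i ∈ s, |a i| ≤ M) : |∑ i ∈ s, a i * b i| ≤ M * ∑ i ∈ s, |b i| := by
  calc |∑ i ∈ s, a i * b i| ≤ ∑ i ∈ s, |a i * b i| := abs_sum_le_sum_abs _ _
    _ ≤ ∑ i ∈ s, M * |b i| := sum_le_sum fun i hi => by
        rw [abs_mul]; exact mul_le_mul_of_nonneg_right (hM i hi) (abs_nonneg _)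
    _ = M * ∑ i ∈ s, |b i| := (mul_sum _ _ _).symm

/-- `|∑ᵢⱼ vᵢ vⱼ gᵢⱼ| ≤ M (∑|vᵢ|)²` if `|gᵢⱼ| ≤ M`. [folklore] -/
theorem abs_sum_sum_mul_le {ι : Type*} (s : Finset ι) {v : ι → ℝ} {g : ι → ι → ℝ} {M : ℝ}
    (hM : ∀ i j, |g i j| ≤ M) :
    |∑ i ∈ s, ∑ j ∈ s, v i * v j * g i j| ≤ M * (∑ i ∈ s, |v i|) ^ 2 := by
  calc |∑ i ∈ s, ∑ j ∈ s, v i * v j * g i j|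
      ≤ ∑ i ∈ s, |∑ j ∈ s, v i * v j * g i j| := abs_sum_le_sum_abs _ _
    _ ≤ ∑ i ∈ s, ∑ j ∈ s, |v i| * |v j| * M := sum_le_sum fun i _ =>
        (abs_sum_le_sum_abs _ _).trans (sum_le_sum fun j _ => by
          rw [abs_mul, abs_mul]
          exact mul_le_mul_of_nonneg_left (hM i j) (by positivity))
    _ = M * (∑ i ∈ s, |v i|) ^ 2 := by
        rw [sq, sum_mul_sum, mul_sum]
        refine sum_congr rfl fun i _ => ?_
        rw [mul_sum]
        exact sum_congr rfl fun j _ => by ring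

/-- `(∑ᵢ|vᵢ|)² ≤ 3 ∑ vᵢ²` on `Fin 3` (Cauchy–Schwarz). [folklore] -/
theorem sq_sum_abs_le_three (v : Fin 3 → ℝ) : (∑ i, |v i|) ^ 2 ≤ 3 * ∑ i, v i ^ 2 := by
  simp only [Fin.sum_univ_three]
  have h0 := sq_abs (v 0); have h1 := sq_abs (v 1); have h2 := sq_abs (v 2)
  nlinarith [sq_nonneg (|v 0| - |v 1|), sq_nonneg (|v 1| - |v 2|), sq_nonneg (|v 0| - |v 2|)]

/-- `∑ᵢ|vᵢ| ≤ (3 + ∑ vᵢ²)/2` on `Fin 3` (`|x| ≤ (1 + x²)/2`). [folklore] -/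
theorem sum_abs_le_three (v : Fin 3 → ℝ) : ∑ i, |v i| ≤ (3 + ∑ i, v i ^ 2) / 2 := by
  simp only [Fin.sum_univ_three]
  have h0 := sq_abs (v 0); have h1 := sq_abs (v 1); have h2 := sq_abs (v 2)
  nlinarith [sq_nonneg (|v 0| - 1), sq_nonneg (|v 1| - 1), sq_nonneg (|v 2| - 1)]

/-- `|∑ᵢ aᵢ bᵢ| ≤ 3 M N` if `|aᵢ| ≤ M`, `|bᵢ| ≤ N` (`Fin 3`). [folklore] -/
theorem abs_sum_mul_le_three {a b : Fin 3 → ℝ} {M N : ℝ} (hM : ∀ i, |a i| ≤ M)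
    (hN : ∀ i, |b i| ≤ N) : |∑ i, a i * b i| ≤ 3 * M * N := by
  have hM0 : 0 ≤ M := (abs_nonneg _).trans (hM 0)
  have h := abs_sum_mul_le (s := univ) (a := a) (b := b) (M := M) fun i _ => hM i
  have h2 : ∑ i, |b i| ≤ 3 * N := by
    simp only [Fin.sum_univ_three]; linarith [hN 0, hN 1, hN 2]
  calc |∑ i, a i * b i| ≤ M * ∑ i, |b i| := h
    _ ≤ M * (3 * N) := mul_le_mul_of_nonneg_left h2 hM0
    _ = 3 * M * N := by ring

/-- `2|a||b| ≤ a² + b²`. [folklore] -/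
theorem two_mul_abs_mul_abs_le (a b : ℝ) : 2 * (|a| * |b|) ≤ a ^ 2 + b ^ 2 := by
  rw [← sq_abs a, ← sq_abs b]; nlinarith [sq_nonneg (|a| - |b|)]

/-- `(|a| + |b|)² ≤ 2(a² + b²)`. [folklore] -/
theorem sq_abs_add_abs_le (a b : ℝ) : (|a| + |b|) ^ 2 ≤ 2 * (a ^ 2 + b ^ 2) := by
  rw [← sq_abs a, ← sq_abs b]; nlinarith [sq_nonneg (|a| - |b|)]

/-- `x y ≤ (x² + y²)/2`. [folklore] -/
theorem mul_le_half_sq_add_sq (x y : ℝ) : x * y ≤ (x ^ 2 + y ^ 2) / 2 := by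
  nlinarith [sq_nonneg (x - y)]

end Inequalities

/-! ## Bounded data -/

namespace StrongPointData

open Finset

/-- All data bounded by `M` in absolute value (componentwise). [folklore] -/
def Bounded (d : StrongPointData) (M : ℝ) : Prop :=
  |d.rt| ≤ M ∧ |d.Θt| ≤ M ∧ (∀ i, |d.U i| ≤ M) ∧ (∀ i, |d.Ut i| ≤ M) ∧ (∀ i, |d.gr i| ≤ M) ∧
    (∀ i, |d.gΘ i| ≤ M) ∧ ∀ i j, |d.gU i j| ≤ M

variable {d : StrongPointData} {M : ℝ}

/-- `|divU| ≤ 3M`. [folklore] -/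
theorem Bounded.abs_divU_le (h : d.Bounded M) : |d.divU| ≤ 3 * M := by
  unfold divU
  calc |∑ i, d.gU i i| ≤ ∑ i, |d.gU i i| := abs_sum_le_sum_abs _ _
    _ ≤ ∑ _i : Fin 3, M := sum_le_sum fun i _ => h.2.2.2.2.2.2 i i
    _ = 3 * M := by simp

/-- `|DₜΘ| ≤ M + 3M²`. [folklore] -/
theorem Bounded.abs_DtΘ_le (h : d.Bounded M) : |d.DtΘ| ≤ M + 3 * M * M := by
  unfold DtΘ
  have := abs_sum_mul_le_three (a := fun i => d.gΘ i) (b := fun i => d.U i) h.2.2.2.2.2.1 h.2.2.1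
  exact (abs_add_le _ _).trans (add_le_add h.2.1 this)

/-- `|Dₜr| ≤ M + 3M²`. [folklore] -/
theorem Bounded.abs_Dtr_le (h : d.Bounded M) : |d.Dtr| ≤ M + 3 * M * M := by
  unfold Dtr
  have := abs_sum_mul_le_three (a := fun i => d.gr i) (b := fun i => d.U i) h.2.2.2.2.1 h.2.2.1
  exact (abs_add_le _ _).trans (add_le_add h.1 this)

/-- `∂ₜp + U·∇p = p_ρ Dₜr + p_ϑ DₜΘ`. [folklore] -/
theorem pt_add_sum (eos : EulerEOS) (d : StrongPointData) :
    d.pt eos + ∑ j, d.U j * d.gp eos j = d.pρ eos * d.Dtr + d.pϑ eos * d.DtΘ := by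
  simp only [pt, gp, Dtr, DtΘ, Fin.sum_univ_three]; ring

end StrongPointData


end CompressibleEuler

end Literature.Analysis.FluidPDE
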